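import Literature.Analysis.FluidPDE.ObukhovCorrsinAnomalousDissipation
import Literature.Analysis.FluidPDE.UniversalTotalAnomalousDissipator
import Literature.Analysis.FunctionSpaces.TorusPeriodization
import Literature.Barriers.AnomalousDissipation.CodimensionOneRigidity
import HarnessLib

/-!
# Mescolini–Pitcho–Sorella: vanishing-diffusivity selection for the advection equation along
fields of class `L¹_loc((0,T]; BV) ∩ L²` — and absence of anomalous dissipation (§§1–2)

G. Mescolini, J. Pitcho, M. Sorella, *On vanishing diffusivity selection for the advection equation*,
Ann. Mat. Pura Appl. (4) **204** (2025), no. 4, 1667–1687, doi:10.1007/s10231-025-01543-6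
(= arXiv:2411.12910; the open-access journal PDF is the text read, its page `N` of 21 is journal page
`1666 + N`; all locators page-confirmed 2026-08-27). [`MescoliniPitchoSorella2025`]

The paper answers, for fields singular ONLY at the initial time, the selection question that
Colombo–Crippa–Sorella (`ColomboCrippaSorella2023_thmB`: a `C^α((0,2) × T^d)` field singular at the
interior time `t = 1` with two distinct vanishing-diffusivity limits) and Armstrong–Vicol
(`ArmstrongVicol2025_prop55`) answer negatively for fields singular at interior/all times: "we prove
that for divergence-free vector fields in `L¹_loc((0,T]; BV(T^d; ℝ^d)) ∩ L²((0,T) × T^d; ℝ^d)`, there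
exists a unique vanishing diffusivity solution. This class includes the vector field constructed by
Depauw …, for which there are infinitely many distinct bounded solutions to the advection equation"
(Abstract, p. 1667), and moreover such fields carry NO anomalous dissipation (Thm. 1.4 (ii)) — the
rigid counterpart, on the scalar side, of the constructions vendored in `TurbPassiveScalar.lean`,
`ObukhovCorrsinAnomalousDissipation.lean`, `AnomalousDissipationAlternatingShears.lean`,
`EulerFlowsScalarAnomalousDissipation.lean` (all of whose carriers are singular at the final time or at
every time).

**Definition 1.1** (p. 1667). "Consider an integrable vector field `b : [0,T] × T^d → ℝ^d`, and an initial
datum `ρ_in ∈ L^∞(T^d)`. We shall say that `ρ ∈ L^∞((0,T) × T^d)` is a bounded weak solution of (PDE)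
[`∂ₜρ + b·∇ρ = 0`, `ρ(0,x) = ρ_in(x)`] along `b`, if for every `φ ∈ C^∞_c([0,T) × T^d)`, we have
`∫₀ᵀ∫_{T^d} [ρ ∂ₜφ + ρ b·∇φ] dx dt = -∫_{T^d} ρ_in(x) φ(0,x) dx`. (1.1)"

**Definition 1.2** (p. 1668). "Consider a vector field `b ∈ L²((0,T) × T^d)`, and an initial datum
`ρ_in ∈ L^∞(T^d)`. For every `ν ∈ (0,1)`, consider the unique bounded solution `ρ^ν` of (ν-PDE)
[`∂ₜρ^ν + div(b ρ^ν) - νΔρ^ν = 0`, `ρ(0,·) = ρ_in`] along `b` with initial datum `ρ_in` independent of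
`ν`. We shall say that `ρ ∈ L^∞((0,T) × T^d)` is a vanishing diffusivity solution along `b` with initial
datum `ρ_in`, if there exists a sequence of real numbers `(νᵢ)_{i∈ℕ}` in `(0,1)` such that `νᵢ ↓ 0` as
`i → +∞`, and `ρ^{νᵢ}` converges to `ρ` weakly-star in `L^∞((0,T) × T^d)` as `i → +∞`."

(p. 1669) "We say that a vector field `b ∈ L²((0,T) × T^d; ℝ^d)` has anomalous dissipation for an initial
datum `ρ_in` if the family of unique weak solutions `{ρ^ν}_{ν∈(0,1)}` of (ν-PDE) satisfies
`limsup_{ν→0} ν ∫₀ᵀ∫_{T^d} |∇ρ^ν|² > 0`." "Recall that a standard mollifier is a function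
`w ∈ C^∞_c((0,1)^d)` such that `w ≥ 0`, and `∫_{(0,1)^d} w(x) dx = 1`, and that it induces a mollification
family `{w^δ}_{δ∈(0,1)}` on `T^d` where we denote `w^δ(x) = w(x/δ)/δ^d`, and we identify `w^δ` with its
periodisation to a function on `T^d`. … `(b ∗ w^δ)(t,x) = ∫_{T^d} b(t,y) w^δ(x - y) dy`. … by the
Cauchy-Lipschitz theory, for any initial datum `ρ_in ∈ L^∞(T^d)`, there exists a unique bounded weak
solution of (PDE) along `b ∗ w^δ`."

**Theorem 1.4** (p. 1669, verbatim). "Consider a divergence-free vector field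
`b ∈ L¹_loc((0,T]; BV(T^d; ℝ^d)) ∩ L²((0,T) × T^d; ℝ^d))`, and an initial datum `ρ_in ∈ L^∞(T^d)`. Then
there exists a unique vanishing diffusivity solution of (PDE) along `b` with initial datum `ρ_in`.
Futhermore, (i) for every standard mollifier `w`, the unique bounded weak solutions `ρ̃^δ` of (PDE) along
`b ∗ w^δ` converge weakly-star in `L^∞((0,T) × T^d)` to the vanishing diffusivity solution as `δ ↓ 0`;
(ii) there is no anomalous dissipation, meaning that the unique bounded weak solutions `ρ^ν` of (ν-PDE)
along `b` with initial datum `ρ_in` satisfy `limsup_{ν↓0} ν ∫₀ᵀ∫_{T^d} |∇ρ^ν(t,x)|² dx dt = 0`."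

**Theorem 2.1** (p. 1670; "We recall the following well-posedness result on (PDE) from [1]" = Ambrosio,
Invent. Math. 158 (2004)). "Consider a divergence-free vector field `b ∈ L¹((0,T); BV(T^d; ℝ^d))`, and an
initial datum `ρ_in ∈ L^∞(T^d)`. Then there exists a unique bounded weak solution of (PDE) along `b`
with initial datum `ρ_in`. Furthermore, up to redefining `ρ` on a zero measure set we have
`ρ ∈ C([0,T]; L²(T^d))`, and `‖ρ(t,·)‖_{L²(T^d)} = ‖ρ_in‖_{L²(T^d)}` for every `t ∈ [0,T]`."

**Definition 2.3** (p. 1671). "Consider a vector field `b ∈ L¹((0,T) × T^d; ℝ^d)` and an initial datum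
`ρ_in ∈ L^∞(T^d)`. We shall say that `ρ ∈ L^∞((0,T) × T^d)` is a bounded weak solution of (ν-PDE) along
`b` with initial datum `ρ_in`, if for every `φ ∈ C^∞_c([0,T) × T^d)`, we have
`∫₀ᵀ∫_{T^d} [ρ ∂ₜφ + b ρ·∇φ - ν ρ Δφ] dx dt = -∫_{T^d} ρ_in(x) φ(0,x) dx`. (2.2)"
[The display prints `-νρΔφ`; for the equation `∂ₜρ + div(bρ) - νΔρ = 0` tested against `φ` the term is
`+νρΔφ` — the sign convention of the tree's `Torus.IsWeakScalarTransportOn` (`+ κΔψ`), which is the one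
used in the proof (energy identity (2.3)); recorded as a print slip, the tree notion is used.]

**Theorem 2.4** (p. 1671, verbatim; "We also provide a proof", pp. 1671–1674). "Consider a
divergence-free vector field `b ∈ L²((0,T) × T^d; ℝ^d)`, an initial datum `ρ_in ∈ L^∞(T^d)`, and a real
number `ν > 0`. Then there exists a unique weak solution `ρ^ν ∈ L^∞((0,T) × T^d) ∩ L²((0,T); H¹(T^d))`
of (ν-PDE) along `b` with initial datum `ρ_in` such that `‖ρ^ν‖_{L^∞((0,T)×T^d)} ≤ ‖ρ_in‖_{L^∞(T^d)}`.
Moreover `ρ^ν` belongs to `C([0,T]; L²(T^d))` up to modification on a zero measure set, and for every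
`t ∈ [0,T]`, `‖ρ^ν(t,·)‖²_{L²(T^d)} + 2ν‖∇ρ^ν‖²_{L²((0,t)×T^d)} ≤ ‖ρ_in‖²_{L²(T^d)}`. (2.3)"

**Proposition 2.5** (p. 1674). "Consider a divergence-free vector field `b ∈ L²((0,T) × T^d; ℝ^d)`, and
an initial datum `ρ_in ∈ L^∞(T^d)`. Then there exists a vanishing diffusivity solution `ρ` with initial
datum `ρ_in`. Furthermore, any subsequence of `{ρ^ν}_{ν∈(0,1)}` converging to `ρ` weakly-star in
`L^∞((0,T) × T^d)` is also converging in `C([0,T]; w-L²(T^d))`."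

## Contents (all in `namespace MescoliniPitchoSorella2025` except the facts)

* `IsBoundedWeakSolution T ν b ρ_in ρ` — **definition** (Def. 1.1 for `ν = 0`, Def. 2.3 for `ν > 0`):
  a weak solution on `T^d × [0,T)` in the tree's sense (`Torus.IsWeakScalarTransportOn T ν b ρ_in ρ`)
  which is essentially bounded on `(0,T) × T^d`.
* `IsBoundedEnergySolution T ν b ρ_in ρ` — **definition**: the class of Thm. 2.4,
  `L^∞((0,T) × T^d) ∩ L²((0,T); H¹(T^d))` (bounded weak solution with `∫₀ᵀ ‖∇ρ(t)‖²_{L²} dt < ∞`,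
  spectral `Torus.eScalarGradNormSq`).
* `IsVanishingDiffusivitySolution T b ρ_in ρ` — **definition** (Def. 1.2).
* `IsStandardMollifier w`, `mollifyDrift w δ b` — **definitions** (p. 1669: `w ∈ C_c^∞((0,1)^d)`,
  `w ≥ 0`, `∫ w = 1`; `b ∗ w^δ` with `w^δ = periodisation of w(·/δ)/δ^d`, via the tree's
  `mollifierScale` and `Torus.periodize`).
* `MescoliniPitchoSorella2025_thm14` — **named fact**: Thm. 1.4 with (i) and (ii).
* `MescoliniPitchoSorella2025_thm24` — **named fact**: Thm. 2.4.
* `MescoliniPitchoSorella2025_thm21` — **named fact**: Thm. 2.1 (Ambrosio 2004, as recalled), in the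
  tree's weak-solution class (see *Rendering*).
* `MescoliniPitchoSorella2025_prop25` — **named fact**: Prop. 2.5, existence clause.

## Rendering (faithfulness notes)

* Function spaces. `b ∈ L²((0,T) × T^d; ℝ^d)` and "Borel": `MemLp (uncurry b) 2 (Torus.slabMeasure d T)`
  (the product of Lebesgue measure on `(0,T)` with the Haar probability measure of `T^d`; it contains
  a.e.-strong measurability). "Divergence-free" (in the sense of distributions on `(0,T) × T^d`, p. 1667)
  for an `L²_{t,x}` field is `Torus.IsWeaklyDivFree (b t)` for a.e. `t ∈ (0,T)` (Fubini), the clause of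
  `Torus.IsWeakScalarTransportOn` and of `DeRosaInversi2024_thm12`. `ρ_in ∈ L^∞(T^d)`:
  `MemLp ρ_in ∞ volume`. `ρ ∈ L^∞((0,T) × T^d)`: `MemLp (uncurry ρ) ∞ (Torus.slabMeasure d T)`.
* `b ∈ L¹_loc((0,T]; BV(T^d; ℝ^d))`: for every `a ∈ (0,T)`, `∫_a^T |Db(t)|(T^d) dt < ∞` with the tree's
  total variation `Literature.Barriers.AnomalousDissipation.torusTotalVariation` (`|Dv|(T^d) = sup
  {∫ ∑ᵢ vᵢ div Φᵢ : Φᵢ ∈ C^∞(T^d; ℝ^d), ∑ᵢ‖Φᵢ‖² ≤ 1}`, `v ∈ BV` iff finite — the rendering of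
  `DeRosaInversi2024_thm12`, REUSED); the `L¹` part of the `BV` norm is implied by `b ∈ L²_{t,x}`.
  Lower Lebesgue integral in `t` (no measurability of `t ↦ |Db(t)|` is asserted, as in
  `DeRosaInversi2024_thm12`).
* "The unique bounded solution `ρ^ν`" (`ν > 0`) is rendered by quantifying over ALL solutions in the
  class of Thm. 2.4 (`IsBoundedEnergySolution`), in which the paper proves existence and uniqueness
  (Thm. 2.4 = `MescoliniPitchoSorella2025_thm24`); "the unique bounded weak solution of (PDE) along
  `b ∗ w^δ`" (Cauchy–Lipschitz, p. 1669) by quantifying over all `IsBoundedWeakSolution T 0 (b ∗ w^δ)`.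
  This is the convention of `ArmstrongVicol2025.DissipatesAlongIntervals` / `HasAnomalousScalarDissipation`.
* Weak-* convergence in `L^∞((0,T) × T^d)`: convergence of `∫∫ ρᵢ φ` for every
  `φ ∈ L¹((0,T) × T^d)` (`Integrable φ (Torus.slabMeasure d T)`), the rendering of
  `Torus.IsScalarLimitPoint` (Colombo–Crippa–Sorella Thm. B); along `δ ↓ 0` / `ν ↓ 0` for a
  real parameter: `Tendsto … (𝓝[>] 0)`. "`νᵢ ↓ 0`": `νᵢ ∈ (0,1)` antitone with `νᵢ → 0`.
* "Unique vanishing diffusivity solution": any two are equal a.e. on `(0,T) × T^d`.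
* (ii) `limsup_{ν↓0} ν‖∇ρ^ν‖²_{L²((0,T)×T^d)} = 0` for a nonnegative quantity is `→ 0` as `ν ↓ 0`:
  `Tendsto (ν ↦ Torus.eScalarDissipation ν (ρ ν) 0 T) (𝓝[>] 0) (𝓝 0)` for every selection
  `ν ↦ ρ ν` of solutions in the class of Thm. 2.4 on `ν ∈ (0,1)` (spectral `κ∫₀ᵀ‖∇θ‖²`, the quantity of
  `Torus.HasAnomalousScalarDissipation`).
* Thm. 2.4: "`ρ^ν ∈ C([0,T]; L²)` up to modification on a zero measure set, and (2.3) for every `t`" is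
  rendered as the existence of a solution in the class which IS an `L²`-continuous representative
  (`Torus.IsL2ContinuousOn (Icc 0 T)`) obeying the maximum principle and (2.3) for every `t ∈ [0,T]`
  (in `ℝ≥0∞`, `‖·‖²_{L²} = Torus.scalarL2Sq`); uniqueness: any two solutions in the class agree a.e. on
  the slab.
* Thm. 2.1 (Ambrosio): the tree's weak-solution notion `Torus.IsWeakScalarTransportOn` carries the
  standing DiPerna–Lions integrability `b ∈ L¹(0,T; L²(T^d))` of the drift, which `L¹_t BV_x` does not
  imply for `d ≥ 3` (`BV(T^d) ⊂ L^{d/(d-1)}`); the fact is therefore typed for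
  `b ∈ L¹((0,T); BV ∩ L²)` — `∫₀ᵀ |Db(t)|(T^d) dt < ∞` AND `∫₀ᵀ ‖b(t)‖_{L²} dt < ∞` — a special case of the
  printed class on which the printed uniqueness (among all bounded weak solutions) implies the typed one.
  `-- TODO(general form): Ambrosio 2004 for b ∈ L¹_t BV_x with bounded divergence, once a weak-solution
  notion with L¹ drifts is in the tree.`
* Prop. 2.5: only the existence clause is typed; "any weakly-* converging subsequence also converges in
  `C([0,T]; w-L²(T^d))`" is a statement about the continuous representatives of Thm. 2.4 and is not
  transcribed.
* Not typed: Remark 1.5 (prose), Remark 1.6 (open question: "It would be interesting to determine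
  whether the vanishing diffusivity solutions of Theorem 1.4 depend continuously on the initial data",
  p. 1670), §3 (backward problems (BW)/(ν-BW), Thms. 3.3, Lemmas 3.6–3.9 — the duality machinery of the
  proof, internal), Lemma 4.1.

No instance, notation or new notion of solution/norm is introduced; every clause is spelled over
existing tree vocabulary (`PassiveScalar`, `ObukhovCorrsinAnomalousDissipation`,
`UniversalTotalAnomalousDissipator`, `DissipationAnomaly`, `TorusPeriodization`, `CodimensionOneRigidity`).
-/

open MeasureTheory Set Filter Topology Function
open scoped ENNReal NNReal Convolution

namespace Literature.Analysis.FluidPDE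

noncomputable section

open Literature.Analysis.FunctionSpaces Literature.Barriers.AnomalousDissipation

namespace MescoliniPitchoSorella2025

variable {d : Type} [Fintype d] [DecidableEq d]

/-- **Bounded weak solutions** (Def. 1.1 p. 1667 for the advection equation, `ν = 0`; Def. 2.3
p. 1671 for the advection–diffusion equation, `ν > 0`): `ρ ∈ L^∞((0,T) × T^d)` satisfying the weak
formulation with datum `ρ_in` against all `φ ∈ C^∞_c([0,T) × T^d)` — the tree's
`Torus.IsWeakScalarTransportOn T ν b ρ_in ρ` (test functions `Torus.IsSpaceTimeTest T`, datum encoded at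
`t = 0`, `+νΔφ`) together with essential boundedness on the slab `(0,T) × T^d`
(`Torus.slabMeasure`). [cite: MescoliniPitchoSorella2025, Def. 1.1 p. 1667 and Def. 2.3 p. 1671] -/
def IsBoundedWeakSolution (T ν : ℝ) (b : ℝ → UnitAddTorus d → EuclideanSpace ℝ d)
    (ρin : UnitAddTorus d → ℝ) (ρ : ℝ → UnitAddTorus d → ℝ) : Prop :=
  Torus.IsWeakScalarTransportOn T ν b ρin ρ ∧ MemLp (uncurry ρ) ∞ (Torus.slabMeasure d T)

/-- **The solution class of Thm. 2.4** (p. 1671): `ρ^ν ∈ L^∞((0,T) × T^d) ∩ L²((0,T); H¹(T^d))`, i.e. a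
bounded weak solution with `∫₀ᵀ ‖∇ρ(t)‖²_{L²(T^d)} dt < ∞` (spectral squared gradient norm
`Torus.eScalarGradNormSq`; the `L²` part of `H¹` is implied by boundedness). "The unique bounded
solution `ρ^ν`" of Def. 1.2 is the unique member of this class (Thm. 2.4).
[cite: MescoliniPitchoSorella2025, Thm. 2.4 p. 1671] -/
def IsBoundedEnergySolution (T ν : ℝ) (b : ℝ → UnitAddTorus d → EuclideanSpace ℝ d)
    (ρin : UnitAddTorus d → ℝ) (ρ : ℝ → UnitAddTorus d → ℝ) : Prop :=
  IsBoundedWeakSolution T ν b ρin ρ ∧ ∫⁻ t in Ioo 0 T, Torus.eScalarGradNormSq (ρ t) < ∞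

/-- **Vanishing diffusivity solutions** (Def. 1.2 p. 1668): `ρ ∈ L^∞((0,T) × T^d)` is a vanishing
diffusivity solution along `b` with datum `ρ_in` if there is a sequence `νᵢ ∈ (0,1)`, `νᵢ ↓ 0`, such that
the (unique) bounded solutions `ρ^{νᵢ}` of the advection–diffusion equation (class of Thm. 2.4,
`IsBoundedEnergySolution`) converge to `ρ` weakly-star in `L^∞((0,T) × T^d)`: `∫∫ ρ^{νᵢ} φ → ∫∫ ρ φ`
for every `φ ∈ L¹((0,T) × T^d)` (the pairing of `Torus.IsScalarLimitPoint`).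
[cite: MescoliniPitchoSorella2025, Def. 1.2 p. 1668] -/
def IsVanishingDiffusivitySolution (T : ℝ) (b : ℝ → UnitAddTorus d → EuclideanSpace ℝ d)
    (ρin : UnitAddTorus d → ℝ) (ρ : ℝ → UnitAddTorus d → ℝ) : Prop :=
  MemLp (uncurry ρ) ∞ (Torus.slabMeasure d T) ∧
    ∃ ν : ℕ → ℝ, (∀ i, ν i ∈ Ioo (0 : ℝ) 1) ∧ Antitone ν ∧ Tendsto ν atTop (𝓝 0) ∧
      ∃ ϱ : ℕ → ℝ → UnitAddTorus d → ℝ, (∀ i, IsBoundedEnergySolution T (ν i) b ρin (ϱ i)) ∧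
        ∀ φ : ℝ × UnitAddTorus d → ℝ, Integrable φ (Torus.slabMeasure d T) →
          Tendsto (fun i => ∫ z, uncurry (ϱ i) z * φ z ∂(Torus.slabMeasure d T)) atTop
            (𝓝 (∫ z, uncurry ρ z * φ z ∂(Torus.slabMeasure d T)))

/-- **Standard mollifiers** (p. 1669): `w ∈ C^∞_c((0,1)^d)` — smooth on `ℝ^d` with compact support
contained in the open unit cube — with `w ≥ 0` and `∫ w = 1`. (Smoothness `C^∞` is
`ContDiff ℝ ⊤`, spelled without the scoped `∞` notation.) [cite: MescoliniPitchoSorella2025, p. 1669 (before Thm. 1.4)] -/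
def IsStandardMollifier (w : EuclideanSpace ℝ d → ℝ) : Prop :=
  ContDiff ℝ ((⊤ : ℕ∞) : WithTop ℕ∞) w ∧ HasCompactSupport w ∧
    tsupport w ⊆ {v | ∀ i, v i ∈ Ioo (0 : ℝ) 1} ∧ (∀ v, 0 ≤ w v) ∧ ∫ v, w v = 1

/-- **The mollified drift `b ∗ w^δ`** (p. 1669): `w^δ(x) = w(x/δ)/δ^d` (the tree's `mollifierScale δ w`)
identified with its periodisation on `T^d` (`Torus.periodize`), and
`(b ∗ w^δ)(t,x) = ∫_{T^d} b(t,y) w^δ(x - y) dy` componentwise (Mathlib's convolution on the compact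
group `T^d`, rough factor on the left as in `Torus.vecMollify`). [cite: MescoliniPitchoSorella2025, p. 1669 (before Thm. 1.4)] -/
def mollifyDrift (w : EuclideanSpace ℝ d → ℝ) (δ : ℝ) (b : ℝ → UnitAddTorus d → EuclideanSpace ℝ d) :
    ℝ → UnitAddTorus d → EuclideanSpace ℝ d :=
  fun t x => WithLp.toLp 2 fun i => ((fun y => b t y i) ⋆ Torus.periodize (mollifierScale δ w)) x

end MescoliniPitchoSorella2025

open MescoliniPitchoSorella2025

/-- **Mescolini–Pitcho–Sorella 2025, Theorem 1.4** (Ann. Mat. Pura Appl. 204 (2025), p. 1669;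
proof §§3–4). Let `T > 0`, let `b : (0,T) × T^d → ℝ^d` be a divergence-free field of class
`L¹_loc((0,T]; BV(T^d; ℝ^d)) ∩ L²((0,T) × T^d; ℝ^d)` — `MemLp (uncurry b) 2` on the slab, weakly
divergence free at a.e. time, and `∫_a^T |Db(t)|(T^d) dt < ∞` for every `a ∈ (0,T)`
(`torusTotalVariation`) — and let `ρ_in ∈ L^∞(T^d)`. Then:
(0) there exists a unique vanishing diffusivity solution (`IsVanishingDiffusivitySolution`; uniqueness
a.e. on `(0,T) × T^d`);
(i) for every standard mollifier `w` (`IsStandardMollifier`), the bounded weak solutions `ρ̃^δ` of the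
advection equation along `b ∗ w^δ` (`IsBoundedWeakSolution T 0 (mollifyDrift w δ b) ρ_in`, unique by
Cauchy–Lipschitz) converge weakly-star in `L^∞((0,T) × T^d)` to the vanishing diffusivity solution as
`δ ↓ 0` — for every selection `δ ↦ ρ̃^δ` on `δ ∈ (0,1)` and every `φ ∈ L¹((0,T) × T^d)`,
`∫∫ ρ̃^δ φ → ∫∫ ρ φ` along `𝓝[>] 0`;
(ii) no anomalous dissipation: for every selection `ν ↦ ρ^ν` of solutions of the advection–diffusion
equation in the class of Thm. 2.4 (`IsBoundedEnergySolution`, in which `ρ^ν` is unique) on `ν ∈ (0,1)`,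
`ν ∫₀ᵀ ‖∇ρ^ν(t)‖²_{L²} dt → 0` as `ν ↓ 0` (`Torus.eScalarDissipation ν (ρ ν) 0 T → 0` along `𝓝[>] 0`;
printed: `limsup_{ν↓0} ν∫₀ᵀ∫|∇ρ^ν|² = 0`). Readings: module docstring, *Rendering*.
[cite: MescoliniPitchoSorella2025, Thm. 1.4 p. 1669; Def. 1.2 p. 1668; Def. 1.1 p. 1667; Def. 2.3 and Thm. 2.4 p. 1671] -/
def MescoliniPitchoSorella2025_thm14 : Prop :=
  ∀ (d : Type) [Fintype d] [DecidableEq d] (T : ℝ) (b : ℝ → UnitAddTorus d → EuclideanSpace ℝ d)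
    (ρin : UnitAddTorus d → ℝ), 0 < T →
    MemLp (uncurry b) 2 (Torus.slabMeasure d T) →
    (∀ᵐ t ∂(volume.restrict (Ioo 0 T)), Torus.IsWeaklyDivFree (b t)) →
    (∀ a : ℝ, 0 < a → a < T → ∫⁻ t in Icc a T, torusTotalVariation (b t) < ∞) →
    MemLp ρin ∞ volume →
    (∃ ρ, IsVanishingDiffusivitySolution T b ρin ρ) ∧
    (∀ ρ₁ ρ₂, IsVanishingDiffusivitySolution T b ρin ρ₁ → IsVanishingDiffusivitySolution T b ρin ρ₂ →
      uncurry ρ₁ =ᵐ[Torus.slabMeasure d T] uncurry ρ₂) ∧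
    (∀ w : EuclideanSpace ℝ d → ℝ, IsStandardMollifier w →
      ∀ ρ, IsVanishingDiffusivitySolution T b ρin ρ →
        ∀ ϱ : ℝ → ℝ → UnitAddTorus d → ℝ,
          (∀ δ ∈ Ioo (0 : ℝ) 1, IsBoundedWeakSolution T 0 (mollifyDrift w δ b) ρin (ϱ δ)) →
          ∀ φ : ℝ × UnitAddTorus d → ℝ, Integrable φ (Torus.slabMeasure d T) →
            Tendsto (fun δ => ∫ z, uncurry (ϱ δ) z * φ z ∂(Torus.slabMeasure d T)) (𝓝[>] 0)
              (𝓝 (∫ z, uncurry ρ z * φ z ∂(Torus.slabMeasure d T)))) ∧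
    (∀ ϱ : ℝ → ℝ → UnitAddTorus d → ℝ,
      (∀ ν ∈ Ioo (0 : ℝ) 1, IsBoundedEnergySolution T ν b ρin (ϱ ν)) →
        Tendsto (fun ν => Torus.eScalarDissipation ν (ϱ ν) 0 T) (𝓝[>] 0) (𝓝 0))

/-- **Mescolini–Pitcho–Sorella 2025, Theorem 2.4** (p. 1671; proof pp. 1671–1674: mollification,
energy estimate, commutator `r^δ → 0` in `L²_t Ḣ⁻¹_x`). Let `T > 0`, `ν > 0`, let `b` be a
divergence-free field in `L²((0,T) × T^d; ℝ^d)` and `ρ_in ∈ L^∞(T^d)`. Then (existence, with the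
printed properties) there is a solution `ρ^ν` of the advection–diffusion equation in the class
`L^∞((0,T) × T^d) ∩ L²((0,T); H¹(T^d))` (`IsBoundedEnergySolution`) with
`‖ρ^ν‖_{L^∞((0,T)×T^d)} ≤ ‖ρ_in‖_{L^∞(T^d)}`, which is (the) `C([0,T]; L²(T^d))` representative
(`Torus.IsL2ContinuousOn (Icc 0 T)`) and satisfies the energy inequality (2.3)
`‖ρ^ν(t)‖²_{L²} + 2ν ∫₀ᵗ ‖∇ρ^ν‖²_{L²} ≤ ‖ρ_in‖²_{L²}` for every `t ∈ [0,T]`; and (uniqueness) any two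
solutions in the class agree a.e. on `(0,T) × T^d`.
[cite: MescoliniPitchoSorella2025, Thm. 2.4 p. 1671, (2.3)] -/
def MescoliniPitchoSorella2025_thm24 : Prop :=
  ∀ (d : Type) [Fintype d] [DecidableEq d] (T ν : ℝ) (b : ℝ → UnitAddTorus d → EuclideanSpace ℝ d)
    (ρin : UnitAddTorus d → ℝ), 0 < T → 0 < ν →
    MemLp (uncurry b) 2 (Torus.slabMeasure d T) →
    (∀ᵐ t ∂(volume.restrict (Ioo 0 T)), Torus.IsWeaklyDivFree (b t)) →
    MemLp ρin ∞ volume →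
    (∃ ρ, IsBoundedEnergySolution T ν b ρin ρ ∧
      eLpNorm (uncurry ρ) ∞ (Torus.slabMeasure d T) ≤ eLpNorm ρin ∞ volume ∧
      Torus.IsL2ContinuousOn (Icc 0 T) ρ ∧
      ∀ t ∈ Icc 0 T, ENNReal.ofReal (Torus.scalarL2Sq (ρ t)) + 2 * Torus.eScalarDissipation ν ρ 0 t ≤
        ENNReal.ofReal (Torus.scalarL2Sq ρin)) ∧
    (∀ ρ₁ ρ₂, IsBoundedEnergySolution T ν b ρin ρ₁ → IsBoundedEnergySolution T ν b ρin ρ₂ →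
      uncurry ρ₁ =ᵐ[Torus.slabMeasure d T] uncurry ρ₂)

/-- **Mescolini–Pitcho–Sorella 2025, Theorem 2.1** (p. 1670) = Ambrosio's well-posedness theorem for
bounded weak solutions of the advection equation along divergence-free `L¹_t BV_x` fields (L. Ambrosio,
Invent. Math. 158 (2004); recalled as Thm. 2.1 with the `L²`-conservation on the continuous
representative), typed in the tree's weak-solution class — which presupposes the DiPerna–Lions
integrability `b ∈ L¹(0,T; L²(T^d))` — hence for `b ∈ L¹((0,T); BV ∩ L²)`: if `T > 0`,
`∫₀ᵀ |Db(t)|(T^d) dt < ∞`, `∫₀ᵀ ‖b(t)‖_{L²} dt < ∞`, `b` jointly measurable and weakly divergence free at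
a.e. time, and `ρ_in ∈ L^∞(T^d)`, then there is a bounded weak solution of `∂ₜρ + b·∇ρ = 0`, `ρ(0) = ρ_in`
on `[0,T)` which is an `L²`-continuous representative on `[0,T]` with `‖ρ(t)‖²_{L²} = ‖ρ_in‖²_{L²}` for
every `t ∈ [0,T]`, and any two bounded weak solutions agree a.e. on `(0,T) × T^d`.
-- TODO(general form): `b ∈ L¹((0,T); BV(T^d; ℝ^d))` only (no `L²`), once the tree has a weak-solution
-- notion with `L¹` drifts; Ambrosio 2004 also allows bounded divergence.
[cite: MescoliniPitchoSorella2025, Thm. 2.1 p. 1670; Ambrosio2004, Invent. Math. 158 (2004) (the result recalled)] -/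
def MescoliniPitchoSorella2025_thm21 : Prop :=
  ∀ (d : Type) [Fintype d] [DecidableEq d] (T : ℝ) (b : ℝ → UnitAddTorus d → EuclideanSpace ℝ d)
    (ρin : UnitAddTorus d → ℝ), 0 < T →
    AEStronglyMeasurable (uncurry b) (Torus.slabMeasure d T) →
    ∫⁻ t in Ioo 0 T, (∫⁻ x, ‖b t x‖ₑ ^ 2) ^ (1 / 2 : ℝ) < ∞ →
    (∀ᵐ t ∂(volume.restrict (Ioo 0 T)), Torus.IsWeaklyDivFree (b t)) →
    ∫⁻ t in Ioo 0 T, torusTotalVariation (b t) < ∞ →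
    MemLp ρin ∞ volume →
    (∃ ρ, IsBoundedWeakSolution T 0 b ρin ρ ∧ Torus.IsL2ContinuousOn (Icc 0 T) ρ ∧
      ∀ t ∈ Icc 0 T, Torus.scalarL2Sq (ρ t) = Torus.scalarL2Sq ρin) ∧
    (∀ ρ₁ ρ₂, IsBoundedWeakSolution T 0 b ρin ρ₁ → IsBoundedWeakSolution T 0 b ρin ρ₂ →
      uncurry ρ₁ =ᵐ[Torus.slabMeasure d T] uncurry ρ₂)

/-- **Mescolini–Pitcho–Sorella 2025, Proposition 2.5 (existence clause)** (p. 1674; proof: weak-*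
compactness from the maximum principle of Thm. 2.4). For `T > 0`, a divergence-free field
`b ∈ L²((0,T) × T^d; ℝ^d)` and `ρ_in ∈ L^∞(T^d)` there exists a vanishing diffusivity solution with
datum `ρ_in` (`IsVanishingDiffusivitySolution`). The second clause (weak-* converging subsequences also
converge in `C([0,T]; w-L²(T^d))`) is not transcribed. [cite: MescoliniPitchoSorella2025, Prop. 2.5 p. 1674] -/
def MescoliniPitchoSorella2025_prop25 : Prop :=
  ∀ (d : Type) [Fintype d] [DecidableEq d] (T : ℝ) (b : ℝ → UnitAddTorus d → EuclideanSpace ℝ d)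
    (ρin : UnitAddTorus d → ℝ), 0 < T →
    MemLp (uncurry b) 2 (Torus.slabMeasure d T) →
    (∀ᵐ t ∂(volume.restrict (Ioo 0 T)), Torus.IsWeaklyDivFree (b t)) →
    MemLp ρin ∞ volume →
    ∃ ρ, IsVanishingDiffusivitySolution T b ρin ρ

end

end Literature.Analysis.FluidPDE
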